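import Summits.CriticalPhenomena.PercolationContinuityZ3.Theorems.Transplant.PlanarSkeletonFrmQuasiDefs
import Summits.CriticalPhenomena.PercolationContinuityZ3.Theorems.Transplant.SkelFrmQuasiBParamsFaceCountsYA
import Summits.CriticalPhenomena.PercolationContinuityZ3.Theorems.Transplant.SkelFrmBParamsFaceCountsYA
import Summits.CriticalPhenomena.PercolationContinuityZ3.Theorems.Transplant.SkelFrmBParamsFaceCountsW
import Summits.CriticalPhenomena.PercolationContinuityZ3.Theorems.Transplant.SkelFrmQuasiBParamsFaceUnits
import HarnessLib
import Summits.CriticalPhenomena.PercolationContinuityZ3.Theorems.Transplant.SkelFrmBParamsFaceCountsWY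
/-!
# GEN-Q PORT (WAVE-Q table v0.8 section 2, row G051, U-level L9; captain R-6/R-7 2026-08-27: carrier token swap `PlanarSkeletonFrmFrom ↦ PlanarSkeletonFrmQuasi`)
# of the tree module «Transplant/SkelFrmFromBParamsFaceCountsWY» (sha256 4f0436698cb2ddae…) onto the quasi-step carrier `PlanarSkeletonFrmQuasi` (p507026): «SkelFrmQuasiBParamsFaceCountsWY»

ORIGINAL TITLE: N2 (frames-only node, OPEN) — (F) column under (R-44)(c): **THE ONE-SIDED TANGENTIAL COUNT OF THE y′-FACE ROUTE** (`σT := 1`, window landing)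

builds on p205010 (kernel theorem, internal audit signed; external expert review pending) — nothing in this file uses p205010; NOTHING is claimed about any open node
((N3-b), the end state).  Lane `prim-bschramm`, seat `prim-bschramm-stmt` (gen 33; GEN-Q column pen; tool = captain gen-1 g4's port_genq.py R-14 --cone + p3-g30's T1 patch).  Helper file (`--supports stmt-CriticalPhenomena-4575 --as helper`).
PORT RULES (U-wave r1–r4 re-used, GEN-Q hunk classes of p3-g29 #6136): declaration order, names and proof texts are those of «SkelFrmFromBParamsFaceCountsWY», byte-identical except
(i) the carrier token `PlanarSkeletonFrmFrom ↦ PlanarSkeletonFrmQuasi` in binders, `namespace`/`end` lines and qualified names (module names `SkelFrmFrom… ↦ SkelFrmQuasi…`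
in imports of already-ported rows); (ii) `Φ.step ↦ Φ.qstep` with the called Steps lemma replaced by its `…Q`/`_q` twin and the cost `Φ.M` threaded (none in this file unless
listed below); (iii) `Φ.cyl_connected ↦ Φ.cyl_reach` readers (none unless listed); (iv) graph-ball radii / window floors ×`Φ.M` (none unless listed).  Carrier-free
residents stay imported/exported from the original «SkelFrmBParamsFaceCountsWY» exactly as in the FrmFrom port.  Docstrings and citations are the original's.

-/

noncomputable section

open scoped Classical

namespace Summit.CriticalPhenomena.PercolationContinuityZ3.Theorems.Transplant

namespace PlanarSkeletonFrmQuasi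

namespace NegB

open Literature.Probability.Percolation Literature.Probability.LatticeModels SimpleGraph
open Literature.Probability.Percolation.KozmaNitzan.Cells (oth sgOf sgOf_sign)
open SkelConc (Consts)
open Skelφ.StepI (DataNS)
open Neg

namespace KS

variable (κ : Consts) {V : Type} [DecidableEq V] [Countable V] {G : SimpleGraph V} [G.LocallyFinite] (Φ : PlanarSkeletonFrmQuasi G) (t : V)
  (p : unitInterval) (D : DataNS V) (g f : ℕ)

/-- **The one-sided tangential count of the y′-face route** (window half-width `bw`): forward x-strides after the forced first one. [this work] -/
def N3WY (κ : Consts) {V : Type} [DecidableEq V] [Countable V] {G : SimpleGraph V} [G.LocallyFinite] (Φ : PlanarSkeletonFrmQuasi G) (t : V) (p : unitInterval) (D : DataNS V) (g : ℕ) (f : ℕ) (P : PCells2T) (yL x : Site 2) (du : MDir) (z : Site 2) (bw : ℕ) : ℕ :=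
  Skelφ.fwdCount (T0Y P x du z) (FcA κ Φ t p D g f yL + u₀A κ Φ t p D g f) (u₀A κ Φ t p D g f).toNat bw

/-- **The one-sided count's spec in `N3Y_spec`'s shape** (sign `1`): the stride budget `u₀·(N+1) ≤ |T0Y − FcA| + 2u₀` and the WINDOW landing
`T0Y − bw ≤ FcA + 1·u₀·(N+1) ≤ T0Y + bw`, from `u₀ ≤ 2bw` and the forward-bounded start `FcA + u₀ ≤ T0Y + bw`.
[cite: KozmaNitzan2024, §4 Lemma 12 (pp. 23–25)] -/
theorem N3WY_spec (κ : Consts) {V : Type} [DecidableEq V] [Countable V] {G : SimpleGraph V} [G.LocallyFinite] (Φ : PlanarSkeletonFrmQuasi G) (t : V) (p : unitInterval) (D : DataNS V) (g : ℕ) (f : ℕ) (P : PCells2T) (yL x : Site 2) (du : MDir) (z : Site 2) {bw : ℕ} (hbw : u₀A κ Φ t p D g f ≤ 2 * (bw : ℤ))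
    (hF : FcA κ Φ t p D g f yL + u₀A κ Φ t p D g f ≤ T0Y P x du z + bw) :
    u₀A κ Φ t p D g f * ((N3WY κ Φ t p D g f P yL x du z bw : ℤ) + 1) ≤ |T0Y P x du z - FcA κ Φ t p D g f yL| + 2 * u₀A κ Φ t p D g f ∧
      T0Y P x du z - bw ≤ FcA κ Φ t p D g f yL + 1 * u₀A κ Φ t p D g f * ((N3WY κ Φ t p D g f P yL x du z bw : ℤ) + 1) ∧
      FcA κ Φ t p D g f yL + 1 * u₀A κ Φ t p D g f * ((N3WY κ Φ t p D g f P yL x du z bw : ℤ) + 1) ≤ T0Y P x du z + bw := by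
  have hu : 1 ≤ u₀A κ Φ t p D g f := (units_eqA κ Φ t p D g f).2.2.2.2.1
  set u := u₀A κ Φ t p D g f with hu_def
  set T := T0Y P x du z
  set F := FcA κ Φ t p D g f yL
  have hun : ((u.toNat : ℕ) : ℤ) = u := Int.toNat_of_nonneg (by linarith)
  have hu0 : 0 < u.toNat := by omega
  have key := Skelφ.fwdCount_spec (T := T) (F := F + u) (bw := bw) hu0 (by rw [hun]; exact hbw) hF
  have up := Skelφ.mul_fwdCount_lt (T := T) (F := F + u) (bw := bw) hu0
  rw [hun] at key up
  have hN : (N3WY κ Φ t p D g f P yL x du z bw : ℤ) = (Skelφ.fwdCount T (F + u) u.toNat bw : ℤ) := rfl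
  rw [hN]
  set N : ℤ := (Skelφ.fwdCount T (F + u) u.toNat bw : ℤ)
  have hN0 : 0 ≤ N := by positivity
  refine ⟨?_, by linarith [key.1], by linarith [key.2]⟩
  -- budget: either no stride beyond the forced one, or the strides stop before the near edge plus one stride
  rcases le_max_iff.1 up with h | h
  · have : u * N ≤ 0 := by linarith
    have hN' : N = 0 := le_antisymm (by nlinarith) hN0
    rw [hN']; linarith [abs_nonneg (T - F)]
  · have hTF : T - F ≤ |T - F| := le_abs_self _
    nlinarith

end KS

end NegB

end PlanarSkeletonFrmQuasi

end Summit.CriticalPhenomena.PercolationContinuityZ3.Theorems.Transplant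

end
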